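import Literature.RepresentationTheory.CompactGroups.OneParameterSubgroups
import HarnessLib

/-!
# Closed connected normal subgroups generated by flows of point derivations

Continuation of `OneParameterSubgroups` (compact Hausdorff group `G`, representative functions
`R = translationFinite G` separating points, augmentation ideal `K`, `K² = K·K`):

* conjugation-invariant subspaces (`IsConjInvariant`), `K²` (`augIdealSq`), and the
  **annihilator** of a subspace in the point derivations; **differentiating the invariance**:
  for conjugation-invariant `V ≤ R`, a point derivation `δ` and `a ∈ V`,
  `rightDeriv δ a - leftDeriv δ a ∈ V` (`IsConjInvariant.rightDeriv_sub_leftDeriv_mem`), hence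
  `⁅δ, δ₂⁆` kills `V` whenever `δ₂` does (`IsConjInvariant.bracket_apply_eq_zero`) — the annihilator
  is a Lie ideal;
* for a conjugation-stable family `𝔥` of point derivations (`IsDerivationFamily`), the closed
  subgroup `flowSubgroup 𝔥` generated by the one-parameter subgroups `γ_δ`, `δ ∈ 𝔥`, is **normal**
  (`g γ_δ(t) g⁻¹ = γ_{δ∘κ_g}(t)`), **closed** and **connected**; if it is trivial every `δ ∈ 𝔥`
  vanishes on `R`; two such subgroups **commute** when all brackets `⁅𝔥₁, 𝔥₂⁆` vanish on `R`; and it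
  acts trivially by right translation on functions whose left derivatives along `𝔥` vanish;
* **point derivations separate `K/W`** for `K² ≤ W < K` (`exists_isPointDerivation_of_lt`);
* the **finite generation of the cotangent space**: if every closed connected normal subgroup of `G`
  is `⊥` or `⊤`, then `K = ((biSpan a + ℝ·1) ∩ K) + K²` for every non-zero `a ∈ K`
  (`sup_augIdealSq_eq_augIdeal`), so `K/K²` is spanned by a finite-dimensional invariant `F' ≤ K`
  (`exists_finiteDimensional_sup_augIdealSq_eq`).

This is the Lie-free replacement for "closed connected normal subgroups ↔ ideals" used in the
structure theorem (`InvariantSubspaces`) behind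
`Literature.MathematicalPhysics.QuantumLattice.isGroupHeatKernel_unique_up_to_scale`. Sources:
G. Hochschild, *The Structure of Lie Groups* (1965), Ch. II–III; J. F. Price, *Lie Groups and
Compact Groups* (1977), §6.4–6.5 (the classical statements being emulated). No named facts.
-/

noncomputable section

open scoped Classical
open NormedSpace Filter Topology MeasureTheory

namespace Literature.RepresentationTheory.CompactGroups

section Structure

variable {G : Type*} [TopologicalSpace G] [Group G] [IsTopologicalGroup G] [CompactSpace G]

/-! ### Conjugation-invariant subspaces, `K²`, and annihilating derivations -/

/-- A subspace of `C(G, ℝ)` is conjugation invariant if it is stable under all `κ_g u = u(g · g⁻¹)`. [folklore] -/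
def IsConjInvariant (V : Submodule ℝ C(G, ℝ)) : Prop :=
  ∀ g : G, ∀ v ∈ V, conjTrans g v ∈ V

variable (G) in
/-- `K² = K·K`, the span of the products of two elements of the augmentation ideal (the functions
vanishing to second order at `1`; `K/K²` is the cotangent space of `G` at `1`). [folklore] -/
abbrev augIdealSq : Submodule ℝ C(G, ℝ) := augIdeal G * augIdeal G

omit [CompactSpace G] in
/-- `K² ≤ K`. [folklore] -/
theorem augIdealSq_le : augIdealSq G ≤ augIdeal G := by
  rw [Submodule.mul_le]
  intro a ha b hb
  exact mul_mem_augIdeal ha hb.1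

omit [CompactSpace G] in
/-- `K ≤ R`. [folklore] -/
theorem augIdeal_le : augIdeal G ≤ Subalgebra.toSubmodule (translationFinite G) := fun _ ha => ha.1

omit [CompactSpace G] in
/-- `K` is conjugation invariant. [folklore] -/
theorem isConjInvariant_augIdeal : IsConjInvariant (augIdeal G) := fun g _ ha => conj_mem_augIdeal ha g

omit [CompactSpace G] in
/-- `K²` is conjugation invariant (`κ_g` is multiplicative). [folklore] -/
theorem isConjInvariant_augIdealSq : IsConjInvariant (augIdealSq G) := by
  intro g v hv
  refine Submodule.mul_induction_on hv (fun a ha b hb => ?_) (fun x y hx hy => ?_)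
  · rw [map_mul]; exact Submodule.mul_mem_mul (conj_mem_augIdeal ha g) (conj_mem_augIdeal hb g)
  · rw [map_add]; exact Submodule.add_mem _ hx hy

omit [CompactSpace G] in
/-- A point derivation kills `K²`. [folklore] -/
theorem IsPointDerivation.apply_eq_zero_of_mem_augIdealSq {δ : C(G, ℝ) →ₗ[ℝ] ℝ}
    (hδ : IsPointDerivation δ) {v : C(G, ℝ)} (hv : v ∈ augIdealSq G) : δ v = 0 := by
  refine Submodule.mul_induction_on hv (fun a ha b hb => hδ.apply_mul_aug ha hb) (fun x y hx hy => ?_)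
  rw [map_add, hx, hy, add_zero]

omit [CompactSpace G] in
/-- A point derivation killing `K` vanishes on `R`. [folklore] -/
theorem IsPointDerivation.apply_eq_zero_of_forall_augIdeal {δ : C(G, ℝ) →ₗ[ℝ] ℝ}
    (hδ : IsPointDerivation δ) (h : ∀ a ∈ augIdeal G, δ a = 0) {u : C(G, ℝ)}
    (hu : u ∈ translationFinite G) : δ u = 0 := by
  rw [← hδ.apply_sub_const u]
  exact h _ (sub_const_mem_augIdeal hu)

/-! ### Differentiating the invariance: `Θ_δ a = rightDeriv δ a - leftDeriv δ a ∈ V` -/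

/-- **The infinitesimal conjugation preserves invariant subspaces.** If `V ≤ R` is conjugation
invariant, `δ` a point derivation and `a ∈ V`, then `rightDeriv δ a - leftDeriv δ a ∈ V`: the curve
`t ↦ a(γ_δ(t) · γ_δ(t)⁻¹)` lies in the finite-dimensional (closed) space `V ∩ biSpan a` and has this
derivative at `0`. [folklore] -/
theorem IsConjInvariant.rightDeriv_sub_leftDeriv_mem [T2Space G] {V : Submodule ℝ C(G, ℝ)}
    (hV : IsConjInvariant V) (hVR : V ≤ Subalgebra.toSubmodule (translationFinite G))
    {δ : C(G, ℝ) →ₗ[ℝ] ℝ} (hδ : IsPointDerivation δ) (hR : (translationFinite G).SeparatesPoints)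
    {a : C(G, ℝ)} (ha : a ∈ V) : rightDeriv δ a - leftDeriv δ a ∈ V := by
  have haR : a ∈ translationFinite G := hVR ha
  set W : Submodule ℝ C(G, ℝ) := V ⊓ biSpan a with hW
  haveI : FiniteDimensional ℝ (biSpan a) := IsTranslationFinite.finiteDimensional haR
  haveI : FiniteDimensional ℝ W := Submodule.finiteDimensional_inf_right _ _
  have hWc : IsClosed (W : Set C(G, ℝ)) := W.closed_of_finiteDimensional
  have hcurve : ∀ t, conjTrans (gammaPt δ t) a ∈ W := fun t =>
    ⟨hV _ _ ha, conjTrans_mem_biSpan _ (self_mem_biSpan a)⟩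
  have hd := hδ.hasDerivAt_conjTrans_gammaPt hR haR
  rw [hasDerivAt_iff_tendsto_slope] at hd
  have hmem : rightDeriv δ a - leftDeriv δ a ∈ closure (W : Set C(G, ℝ)) := by
    refine mem_closure_of_tendsto hd (Eventually.of_forall fun t => ?_)
    rw [slope_def_module]
    refine W.smul_mem _ (W.sub_mem (hcurve t) ?_)
    have : conjTrans (gammaPt δ 0) a = a := by rw [hδ.gammaPt_zero hR, conjTrans_one]
    rw [this]
    exact ⟨ha, self_mem_biSpan a⟩
  rw [hWc.closure_eq] at hmem
  exact hmem.1

/-- **Brackets with annihilators stay in the annihilator**: if `V ≤ R` is conjugation invariant,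
`δ`, `δ₂` are point derivations and `δ₂` kills `V`, then `⁅δ, δ₂⁆` kills `V`
(`⁅δ, δ₂⁆ a = δ₂ (rightDeriv δ a - leftDeriv δ a)`). [folklore] -/
theorem IsConjInvariant.bracket_apply_eq_zero [T2Space G] {V : Submodule ℝ C(G, ℝ)}
    (hV : IsConjInvariant V) (hVR : V ≤ Subalgebra.toSubmodule (translationFinite G))
    {δ δ₂ : C(G, ℝ) →ₗ[ℝ] ℝ} (hδ : IsPointDerivation δ) (hR : (translationFinite G).SeparatesPoints)
    (hδ₂ : ∀ v ∈ V, δ₂ v = 0) {a : C(G, ℝ)} (ha : a ∈ V) : bracket δ δ₂ a = 0 := by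
  rw [bracket_eq_apply_rightDeriv_sub δ δ₂ (hVR ha), ← map_sub]
  exact hδ₂ _ (hV.rightDeriv_sub_leftDeriv_mem hVR hδ hR ha)

/-! ### Normal subgroups generated by the flows of a family of point derivations -/

/-- A **conjugation-stable family of point derivations** (the would-be ideal of the Lie algebra). [folklore] -/
structure IsDerivationFamily (𝔥 : Set (C(G, ℝ) →ₗ[ℝ] ℝ)) : Prop where
  isPointDerivation : ∀ δ ∈ 𝔥, IsPointDerivation δ
  comp_conjTrans_mem : ∀ δ ∈ 𝔥, ∀ g : G, δ.comp (conjTrans g).toLinearMap ∈ 𝔥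

/-- The family of point derivations annihilating a conjugation-invariant subspace. [folklore] -/
def annihilator (V : Submodule ℝ C(G, ℝ)) : Set (C(G, ℝ) →ₗ[ℝ] ℝ) :=
  {δ | IsPointDerivation δ ∧ ∀ v ∈ V, δ v = 0}

omit [CompactSpace G] in
/-- The annihilator of a conjugation-invariant subspace is a conjugation-stable family. [folklore] -/
theorem isDerivationFamily_annihilator {V : Submodule ℝ C(G, ℝ)} (hV : IsConjInvariant V) :
    IsDerivationFamily (annihilator V) :=
  ⟨fun _ h => h.1, fun δ h g => ⟨h.1.comp_conjTrans g, fun v hv => by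
    simp only [LinearMap.comp_apply, AlgHom.toLinearMap_apply]; exact h.2 _ (hV g v hv)⟩⟩

/-- The set of points `γ_δ(t)`, `δ ∈ 𝔥`, `t ∈ ℝ`. [folklore] -/
def flowSet (𝔥 : Set (C(G, ℝ) →ₗ[ℝ] ℝ)) : Set G :=
  {x | ∃ δ ∈ 𝔥, ∃ t : ℝ, x = gammaPt δ t}

/-- **The closed subgroup generated by the one-parameter subgroups of a family of derivations.** [folklore] -/
def flowSubgroup (𝔥 : Set (C(G, ℝ) →ₗ[ℝ] ℝ)) : Subgroup G :=
  (Subgroup.closure (flowSet 𝔥)).topologicalClosure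

omit [CompactSpace G] in
/-- `γ_δ(t) ∈ flowSet 𝔥` for `δ ∈ 𝔥`. [folklore] -/
theorem gammaPt_mem_flowSet {𝔥 : Set (C(G, ℝ) →ₗ[ℝ] ℝ)} {δ : C(G, ℝ) →ₗ[ℝ] ℝ} (hδ : δ ∈ 𝔥) (t : ℝ) :
    gammaPt δ t ∈ flowSet 𝔥 := ⟨δ, hδ, t, rfl⟩

omit [CompactSpace G] in
/-- `γ_δ(t) ∈ flowSubgroup 𝔥` for `δ ∈ 𝔥`. [folklore] -/
theorem gammaPt_mem_flowSubgroup {𝔥 : Set (C(G, ℝ) →ₗ[ℝ] ℝ)} {δ : C(G, ℝ) →ₗ[ℝ] ℝ} (hδ : δ ∈ 𝔥)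
    (t : ℝ) : gammaPt δ t ∈ flowSubgroup 𝔥 :=
  Subgroup.le_topologicalClosure _ (Subgroup.subset_closure (gammaPt_mem_flowSet hδ t))

/-- `flowSet 𝔥` is conjugation invariant (`g γ_δ(t) g⁻¹ = γ_{δ∘κ_g}(t)`). [folklore] -/
theorem conj_mem_flowSet {𝔥 : Set (C(G, ℝ) →ₗ[ℝ] ℝ)} (h𝔥 : IsDerivationFamily 𝔥)
    (hR : (translationFinite G).SeparatesPoints) {x : G} (hx : x ∈ flowSet 𝔥) (g : G) :
    g * x * g⁻¹ ∈ flowSet 𝔥 := by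
  obtain ⟨δ, hδ, t, rfl⟩ := hx
  exact ⟨_, h𝔥.comp_conjTrans_mem δ hδ g, t, (h𝔥.isPointDerivation δ hδ).conj_gammaPt hR g t⟩

/-- The subgroup generated by `flowSet 𝔥` is normal. [folklore] -/
theorem normal_closure_flowSet {𝔥 : Set (C(G, ℝ) →ₗ[ℝ] ℝ)} (h𝔥 : IsDerivationFamily 𝔥)
    (hR : (translationFinite G).SeparatesPoints) : (Subgroup.closure (flowSet 𝔥)).Normal := by
  refine ⟨fun n hn g => ?_⟩
  refine Subgroup.closure_induction (p := fun n _ => g * n * g⁻¹ ∈ Subgroup.closure (flowSet 𝔥))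
    (fun x hx => Subgroup.subset_closure (conj_mem_flowSet h𝔥 hR hx g)) (by simp)
    (fun x y _ _ hx hy => ?_) (fun x _ hx => ?_) hn
  · have : g * (x * y) * g⁻¹ = (g * x * g⁻¹) * (g * y * g⁻¹) := by group
    rw [this]; exact Subgroup.mul_mem _ hx hy
  · have : g * x⁻¹ * g⁻¹ = (g * x * g⁻¹)⁻¹ := by group
    rw [this]; exact Subgroup.inv_mem _ hx

/-- **`flowSubgroup 𝔥` is a closed normal subgroup.** [folklore] -/
theorem normal_flowSubgroup {𝔥 : Set (C(G, ℝ) →ₗ[ℝ] ℝ)} (h𝔥 : IsDerivationFamily 𝔥)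
    (hR : (translationFinite G).SeparatesPoints) : (flowSubgroup 𝔥).Normal := by
  haveI := normal_closure_flowSet h𝔥 hR
  exact Subgroup.is_normal_topologicalClosure _

omit [CompactSpace G] in
/-- `flowSubgroup 𝔥` is closed. [folklore] -/
theorem isClosed_flowSubgroup (𝔥 : Set (C(G, ℝ) →ₗ[ℝ] ℝ)) : IsClosed (flowSubgroup 𝔥 : Set G) :=
  Subgroup.isClosed_topologicalClosure _

/-- **`flowSubgroup 𝔥` is connected**: every element of the generated subgroup is joined to `1`
inside it by a connected set built from the curves `γ_δ`. [folklore] -/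
theorem isPreconnected_flowSubgroup [T2Space G] {𝔥 : Set (C(G, ℝ) →ₗ[ℝ] ℝ)}
    (h𝔥 : IsDerivationFamily 𝔥) (hR : (translationFinite G).SeparatesPoints) :
    IsPreconnected (flowSubgroup 𝔥 : Set G) := by
  rw [flowSubgroup, Subgroup.topologicalClosure_coe]
  refine IsPreconnected.closure ?_
  set H := Subgroup.closure (flowSet 𝔥) with hH
  -- every element is joined to `1` by a preconnected subset of `H`
  have key : ∀ x ∈ H, ∃ C : Set G, C ⊆ H ∧ IsPreconnected C ∧ (1 : G) ∈ C ∧ x ∈ C := by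
    intro x hx
    refine Subgroup.closure_induction (p := fun x _ => ∃ C : Set G, C ⊆ H ∧ IsPreconnected C ∧ (1 : G) ∈ C ∧ x ∈ C)
      (fun x hx => ?_) ⟨{1}, by simp [hH], isPreconnected_singleton, rfl, rfl⟩
      (fun x y _ _ hx hy => ?_) (fun x _ hx => ?_) hx
    · obtain ⟨δ, hδ, t, rfl⟩ := hx
      have hpd := h𝔥.isPointDerivation δ hδ
      refine ⟨Set.range (gammaPt δ), ?_, hpd.isPreconnected_range_gammaPt hR, ⟨0, hpd.gammaPt_zero hR⟩, ⟨t, rfl⟩⟩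
      rintro _ ⟨s, rfl⟩
      exact Subgroup.subset_closure (gammaPt_mem_flowSet hδ s)
    · obtain ⟨Cx, hCxH, hCx, h1x, hxx⟩ := hx
      obtain ⟨Cy, hCyH, hCy, h1y, hyy⟩ := hy
      refine ⟨Cx ∪ (fun z => x * z) '' Cy, ?_, ?_, Or.inl h1x, Or.inr ⟨y, hyy, rfl⟩⟩
      · rintro z (hz | ⟨w, hw, rfl⟩)
        · exact hCxH hz
        · exact H.mul_mem (hCxH hxx) (hCyH hw)
      · refine IsPreconnected.union x hxx ⟨1, h1y, mul_one x⟩ hCx (hCy.image _ (by fun_prop))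
    · obtain ⟨Cx, hCxH, hCx, h1x, hxx⟩ := hx
      refine ⟨(fun z => z⁻¹) '' Cx, ?_, hCx.image _ (by fun_prop), ⟨1, h1x, inv_one⟩, ⟨x, hxx, rfl⟩⟩
      rintro _ ⟨w, hw, rfl⟩
      exact H.inv_mem (hCxH hw)
  refine isPreconnected_of_forall (1 : G) fun y hy => ?_
  obtain ⟨C, hCH, hC, h1, hyC⟩ := key y hy
  exact ⟨C, hCH, h1, hyC, hC⟩

/-- **If the flows of `𝔥` generate only the trivial subgroup, every `δ ∈ 𝔥` vanishes on `R`.** [folklore] -/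
theorem apply_eq_zero_of_flowSubgroup_eq_bot {𝔥 : Set (C(G, ℝ) →ₗ[ℝ] ℝ)} (h𝔥 : IsDerivationFamily 𝔥)
    (hbot : flowSubgroup 𝔥 = ⊥) {δ : C(G, ℝ) →ₗ[ℝ] ℝ} (hδ : δ ∈ 𝔥) {u : C(G, ℝ)}
    (hu : u ∈ translationFinite G) : δ u = 0 := by
  by_contra hne
  obtain ⟨t, ht⟩ := (h𝔥.isPointDerivation δ hδ).exists_gammaPt_ne_one hu hne
  have := gammaPt_mem_flowSubgroup hδ t
  rw [hbot, Subgroup.mem_bot] at this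
  exact ht this

omit [CompactSpace G] in
/-- Centralizers of sets are closed in a Hausdorff topological group. [folklore] -/
theorem isClosed_centralizer [T2Space G] (s : Set G) : IsClosed (Subgroup.centralizer s : Set G) := by
  have : (Subgroup.centralizer s : Set G) = ⋂ a ∈ s, {g : G | a * g = g * a} := by
    ext g; simp [Subgroup.mem_centralizer_iff]
  rw [this]
  exact isClosed_biInter fun a _ => isClosed_eq (by fun_prop) (by fun_prop)

/-- **Commuting flow subgroups**: if `⁅δ₁, δ₂⁆ = 0` on `R` for all `δ₁ ∈ 𝔥₁`, `δ₂ ∈ 𝔥₂`, then the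
closed subgroups generated by their flows commute elementwise. [folklore] -/
theorem commute_of_bracket_eq_zero [T2Space G] {𝔥₁ 𝔥₂ : Set (C(G, ℝ) →ₗ[ℝ] ℝ)}
    (h₁ : IsDerivationFamily 𝔥₁) (h₂ : IsDerivationFamily 𝔥₂) (hR : (translationFinite G).SeparatesPoints)
    (hbr : ∀ δ₁ ∈ 𝔥₁, ∀ δ₂ ∈ 𝔥₂, ∀ u ∈ translationFinite G, bracket δ₁ δ₂ u = 0)
    {x y : G} (hx : x ∈ flowSubgroup 𝔥₁) (hy : y ∈ flowSubgroup 𝔥₂) : x * y = y * x := by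
  -- generators commute
  have hgen : flowSet 𝔥₂ ⊆ Subgroup.centralizer (flowSet 𝔥₁) := by
    rintro _ ⟨δ₂, hδ₂, t, rfl⟩
    rw [SetLike.mem_coe, Subgroup.mem_centralizer_iff]
    rintro _ ⟨δ₁, hδ₁, s, rfl⟩
    exact (h₁.isPointDerivation δ₁ hδ₁).gammaPt_comm_of_bracket_eq_zero (h₂.isPointDerivation δ₂ hδ₂)
      hR (hbr δ₁ hδ₁ δ₂ hδ₂) s t
  have hH₂ : Subgroup.closure (flowSet 𝔥₂) ≤ Subgroup.centralizer (flowSet 𝔥₁) :=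
    (Subgroup.closure_le _).mpr hgen
  -- hence the first closure centralises the second closure
  have hS₁ : flowSet 𝔥₁ ⊆ Subgroup.centralizer (Subgroup.closure (flowSet 𝔥₂) : Set G) := by
    intro a ha
    rw [SetLike.mem_coe, Subgroup.mem_centralizer_iff]
    intro b hb
    exact ((Subgroup.mem_centralizer_iff.mp (hH₂ hb)) a ha).symm
  have hH₁ : Subgroup.closure (flowSet 𝔥₁) ≤ Subgroup.centralizer (Subgroup.closure (flowSet 𝔥₂) : Set G) :=
    (Subgroup.closure_le _).mpr hS₁
  have hM₁ : flowSubgroup 𝔥₁ ≤ Subgroup.centralizer (Subgroup.closure (flowSet 𝔥₂) : Set G) :=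
    Subgroup.topologicalClosure_minimal _ hH₁ (isClosed_centralizer _)
  have hH₂' : Subgroup.closure (flowSet 𝔥₂) ≤ Subgroup.centralizer (flowSubgroup 𝔥₁ : Set G) := by
    intro b hb
    rw [Subgroup.mem_centralizer_iff]
    intro a ha
    exact ((Subgroup.mem_centralizer_iff.mp (hM₁ ha)) b hb).symm
  have hM₂ : flowSubgroup 𝔥₂ ≤ Subgroup.centralizer (flowSubgroup 𝔥₁ : Set G) :=
    Subgroup.topologicalClosure_minimal _ hH₂' (isClosed_centralizer _)
  exact (Subgroup.mem_centralizer_iff.mp (hM₂ hy)) x hx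

/-- **Flow subgroups act trivially where all derivations of the family act trivially**: if
`leftDeriv δ u = 0` for all `δ ∈ 𝔥` then `u(· m) = u` for all `m ∈ flowSubgroup 𝔥`. [folklore] -/
theorem rTrans_eq_self_of_mem_flowSubgroup {𝔥 : Set (C(G, ℝ) →ₗ[ℝ] ℝ)} (h𝔥 : IsDerivationFamily 𝔥)
    {u : C(G, ℝ)} (hu : u ∈ translationFinite G) (h0 : ∀ δ ∈ 𝔥, leftDeriv δ u = 0)
    {m : G} (hm : m ∈ flowSubgroup 𝔥) : rTrans m u = u := by
  have hclosed : IsClosed {g : G | rTrans g u = u} := by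
    have : {g : G | rTrans g u = u} = ⋂ x : G, {g : G | u (x * g) = u x} := by
      ext g
      simp only [Set.mem_setOf_eq, Set.mem_iInter]
      constructor
      · intro h x; rw [← rTrans_apply g u x, h]
      · intro h; ext x; rw [rTrans_apply]; exact h x
    rw [this]
    exact isClosed_iInter fun x => isClosed_eq (u.continuous.comp (continuous_const.mul continuous_id))
      continuous_const
  have hH : Subgroup.closure (flowSet 𝔥) ≤ ⟨⟨⟨{g : G | rTrans g u = u}, fun {a b} ha hb => by
      show rTrans (a * b) u = u
      rw [← rTrans_rTrans, hb, ha]⟩, by show rTrans 1 u = u; exact rTrans_one u⟩, fun {a} ha => by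
      show rTrans a⁻¹ u = u
      have h := congrArg (rTrans a⁻¹) ha
      rw [rTrans_rTrans, inv_mul_cancel, rTrans_one] at h
      exact h.symm⟩ := by
    rw [Subgroup.closure_le]
    rintro _ ⟨δ, hδ, t, rfl⟩
    show rTrans (gammaPt δ t) u = u
    rw [← (h𝔥.isPointDerivation δ hδ).flow_eq_rTrans hu]
    exact flow_eq_self_of_leftDeriv_eq_zero δ hu (h0 δ hδ) t
  exact Subgroup.topologicalClosure_minimal _ hH hclosed hm

/-! ### Extending functionals on `K/W` to point derivations; finite generation of `K/K²` -/

omit [CompactSpace G] in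
/-- **Point derivations separate `K/W` for `K² ≤ W < K`**: there is a point derivation vanishing on
`W` but not on all of `R` (extend a functional on `K/W` by `δ(u) = λ(u - u(1))`; the Leibniz rule
holds because `(u - u(1))(v - v(1)) ∈ K² ⊆ W`). [folklore] -/
theorem exists_isPointDerivation_of_lt {W : Submodule ℝ C(G, ℝ)} (h2 : augIdealSq G ≤ W)
    (hlt : W < augIdeal G) :
    ∃ δ : C(G, ℝ) →ₗ[ℝ] ℝ, IsPointDerivation δ ∧ (∀ w ∈ W, δ w = 0) ∧
      ∃ u ∈ translationFinite G, δ u ≠ 0 := by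
  obtain ⟨b, hbK, hbW⟩ := SetLike.exists_of_lt hlt
  -- the functional on `K`, vanishing on `W`, non-zero at `b`
  set W' : Submodule ℝ (augIdeal G) := W.comap (augIdeal G).subtype with hW'
  have hbq : W'.mkQ ⟨b, hbK⟩ ≠ 0 := by
    rw [Ne, Submodule.mkQ_apply, Submodule.Quotient.mk_eq_zero]
    exact hbW
  obtain ⟨φ, hφ⟩ : ∃ φ : Module.Dual ℝ (augIdeal G ⧸ W'), φ (W'.mkQ ⟨b, hbK⟩) ≠ 0 := by
    by_contra h
    push Not at h
    exact hbq ((Module.forall_dual_apply_eq_zero_iff ℝ _).mp h)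
  set lam : augIdeal G →ₗ[ℝ] ℝ := φ.comp W'.mkQ with hlam
  have hlamW : ∀ w (hw : w ∈ augIdeal G), w ∈ W → lam ⟨w, hw⟩ = 0 := by
    intro w hw hwW
    simp only [hlam, LinearMap.comp_apply, Submodule.mkQ_apply]
    rw [(Submodule.Quotient.mk_eq_zero W').mpr (show (⟨w, hw⟩ : augIdeal G) ∈ W' from hwW), map_zero]
  -- the derivation on `R`: `δ u = λ (u - u(1))`
  set δR : Subalgebra.toSubmodule (translationFinite G) →ₗ[ℝ] ℝ :=
    { toFun := fun u => lam ⟨(u : C(G, ℝ)) - algebraMap ℝ C(G, ℝ) ((u : C(G, ℝ)) 1),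
        sub_const_mem_augIdeal u.2⟩
      map_add' := fun u v => by
        rw [← map_add]; congr 1; apply Subtype.ext
        simp only [Submodule.coe_add, ContinuousMap.add_apply, map_add, AddMemClass.mk_add_mk]
        abel
      map_smul' := fun c u => by
        rw [RingHom.id_apply, ← map_smul]; congr 1; apply Subtype.ext
        simp only [Submodule.coe_smul, ContinuousMap.smul_apply, smul_eq_mul, SetLike.mk_smul_mk,
          Algebra.algebraMap_eq_smul_one, smul_sub, smul_smul] } with hδR
  obtain ⟨δ, hδ⟩ := LinearMap.exists_extend δR
  have hδapp : ∀ u (hu : u ∈ translationFinite G),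
      δ u = lam ⟨u - algebraMap ℝ C(G, ℝ) (u 1), sub_const_mem_augIdeal hu⟩ := by
    intro u hu
    have := LinearMap.congr_fun hδ ⟨u, hu⟩
    simpa [hδR] using this
  refine ⟨δ, ?_, ?_, b, hbK.1, ?_⟩
  · -- Leibniz
    intro u hu v hv
    rw [hδapp _ ((translationFinite G).mul_mem hu hv), hδapp u hu, hδapp v hv]
    have hprod : (u - algebraMap ℝ C(G, ℝ) (u 1)) * (v - algebraMap ℝ C(G, ℝ) (v 1)) ∈ W :=
      h2 (Submodule.mul_mem_mul (sub_const_mem_augIdeal hu) (sub_const_mem_augIdeal hv))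
    have hkey : (⟨u * v - algebraMap ℝ C(G, ℝ) ((u * v) 1), sub_const_mem_augIdeal
        ((translationFinite G).mul_mem hu hv)⟩ : augIdeal G) =
        (u 1) • ⟨v - algebraMap ℝ C(G, ℝ) (v 1), sub_const_mem_augIdeal hv⟩ +
        (v 1) • ⟨u - algebraMap ℝ C(G, ℝ) (u 1), sub_const_mem_augIdeal hu⟩ +
        ⟨_, (augIdealSq_le.trans le_rfl) (Submodule.mul_mem_mul (sub_const_mem_augIdeal hu)
          (sub_const_mem_augIdeal hv))⟩ := by
      apply Subtype.ext
      simp only [Submodule.coe_add, Submodule.coe_smul, ContinuousMap.mul_apply,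
        Algebra.algebraMap_eq_smul_one]
      ext x
      simp only [ContinuousMap.sub_apply, ContinuousMap.mul_apply, ContinuousMap.add_apply,
        ContinuousMap.smul_apply, ContinuousMap.one_apply, smul_eq_mul]
      ring
    rw [hkey, map_add, map_add, map_smul, map_smul, hlamW _ _ hprod, add_zero, smul_eq_mul, smul_eq_mul]
  · intro w hw
    have hwK : w ∈ augIdeal G := hlt.le hw
    rw [hδapp w hwK.1]
    have : (⟨w - algebraMap ℝ C(G, ℝ) (w 1), sub_const_mem_augIdeal hwK.1⟩ : augIdeal G) = ⟨w, hwK⟩ := by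
      apply Subtype.ext; simp [apply_one_of_mem_augIdeal hwK]
    rw [this]
    exact hlamW w hwK hw
  · rw [hδapp b hbK.1]
    have : (⟨b - algebraMap ℝ C(G, ℝ) (b 1), sub_const_mem_augIdeal hbK.1⟩ : augIdeal G) = ⟨b, hbK⟩ := by
      apply Subtype.ext; simp [apply_one_of_mem_augIdeal hbK]
    rw [this]
    exact hφ

omit [CompactSpace G] in
/-- Intersections with `K`, sums: conjugation invariance is preserved. [folklore] -/
theorem IsConjInvariant.inf {V W : Submodule ℝ C(G, ℝ)} (hV : IsConjInvariant V) (hW : IsConjInvariant W) :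
    IsConjInvariant (V ⊓ W) := fun g _ hv => ⟨hV g _ hv.1, hW g _ hv.2⟩

omit [CompactSpace G] in
/-- Sums of conjugation-invariant subspaces are conjugation invariant. [folklore] -/
theorem IsConjInvariant.sup {V W : Submodule ℝ C(G, ℝ)} (hV : IsConjInvariant V) (hW : IsConjInvariant W) :
    IsConjInvariant (V ⊔ W) := by
  intro g v hv
  obtain ⟨a, ha, b, hb, rfl⟩ := Submodule.mem_sup.mp hv
  rw [map_add]
  exact Submodule.add_mem_sup (hV g a ha) (hW g b hb)

omit [CompactSpace G] in
/-- The finite-dimensional bi-invariant space `biSpan a + ℝ·1`. It is conjugation invariant,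
left invariant and contains the constants. [folklore] -/
theorem isConjInvariant_biSpan_sup_one (a : C(G, ℝ)) :
    IsConjInvariant (biSpan a ⊔ Submodule.span ℝ {(1 : C(G, ℝ))}) := by
  intro g v hv
  obtain ⟨b, hb, c, hc, rfl⟩ := Submodule.mem_sup.mp hv
  rw [map_add]
  refine Submodule.add_mem_sup (conjTrans_mem_biSpan g hb) ?_
  obtain ⟨r, rfl⟩ := Submodule.mem_span_singleton.mp hc
  rw [map_smul, map_one]
  exact Submodule.smul_mem _ r (Submodule.mem_span_singleton_self _)

omit [CompactSpace G] in
/-- `biSpan a + ℝ·1` is left invariant. [folklore] -/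
theorem lTrans_mem_biSpan_sup_one {a v : C(G, ℝ)} (g : G)
    (hv : v ∈ biSpan a ⊔ Submodule.span ℝ {(1 : C(G, ℝ))}) :
    lTrans g v ∈ biSpan a ⊔ Submodule.span ℝ {(1 : C(G, ℝ))} := by
  obtain ⟨b, hb, c, hc, rfl⟩ := Submodule.mem_sup.mp hv
  rw [map_add]
  refine Submodule.add_mem_sup (lTrans_mem_biSpan g hb) ?_
  obtain ⟨r, rfl⟩ := Submodule.mem_span_singleton.mp hc
  rw [map_smul, map_one]
  exact Submodule.smul_mem _ r (Submodule.mem_span_singleton_self _)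

/-- **Finite generation of the cotangent space `K/K²` on a group without proper closed connected
normal subgroups.** If every closed connected normal subgroup of the compact Hausdorff group `G`
is `⊥` or `⊤` and `R` separates points, then for every non-zero `a ∈ K`,
`K = ((biSpan a + ℝ·1) ∩ K) + K²`. Proof: otherwise there is a point derivation `δ ≠ 0` killing
`W = ((biSpan a + ℝ·1) ∩ K) + K²`; the derivations killing `W` form a conjugation-stable family
whose flows fix `biSpan a + ℝ·1` pointwise under right translation; the closed connected normal
subgroup they generate is then `⊥` (so `δ = 0`, absurd) or `⊤` (so `a(· g) = a` for all `g`, i.e.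
`a` is constant, `a = a(1) = 0`, absurd). [folklore] -/
theorem sup_augIdealSq_eq_augIdeal [T2Space G]
    (hN : ∀ N : Subgroup G, N.Normal → IsClosed (N : Set G) → IsPreconnected (N : Set G) → N = ⊥ ∨ N = ⊤)
    (hR : (translationFinite G).SeparatesPoints) {a : C(G, ℝ)} (ha : a ∈ augIdeal G) (ha0 : a ≠ 0) :
    ((biSpan a ⊔ Submodule.span ℝ {(1 : C(G, ℝ))}) ⊓ augIdeal G) ⊔ augIdealSq G = augIdeal G := by
  set F : Submodule ℝ C(G, ℝ) := biSpan a ⊔ Submodule.span ℝ {(1 : C(G, ℝ))} with hF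
  have haR : a ∈ translationFinite G := ha.1
  have hFR : F ≤ Subalgebra.toSubmodule (translationFinite G) :=
    sup_le (biSpan_le_translationFinite haR)
      ((Submodule.span_singleton_le_iff_mem _ _).mpr (translationFinite G).one_mem)
  have h1F : (1 : C(G, ℝ)) ∈ F := Submodule.mem_sup_right (Submodule.mem_span_singleton_self _)
  set W : Submodule ℝ C(G, ℝ) := (F ⊓ augIdeal G) ⊔ augIdealSq G with hW
  have hW2 : augIdealSq G ≤ W := le_sup_right
  have hWK : W ≤ augIdeal G := sup_le inf_le_right augIdealSq_le
  by_contra hne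
  have hlt : W < augIdeal G := lt_of_le_of_ne hWK hne
  obtain ⟨δ, hδ, hδW, u₀, hu₀, hδu₀⟩ := exists_isPointDerivation_of_lt hW2 hlt
  -- the family of derivations killing `W`
  have hWinv : IsConjInvariant W :=
    ((isConjInvariant_biSpan_sup_one a).inf isConjInvariant_augIdeal).sup isConjInvariant_augIdealSq
  have hfam := isDerivationFamily_annihilator hWinv
  have hδmem : δ ∈ annihilator W := ⟨hδ, hδW⟩
  -- every derivation of the family kills the left derivatives of `F`
  have hkill : ∀ δ' ∈ annihilator W, ∀ u ∈ F, leftDeriv δ' u = 0 := by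
    intro δ' hδ' u hu
    ext x
    rw [leftDeriv_apply δ' (hFR hu), ContinuousMap.zero_apply]
    have hv : lTrans x u ∈ F := lTrans_mem_biSpan_sup_one x hu
    have hvR : lTrans x u ∈ translationFinite G := hFR hv
    have hsplit : lTrans x u = (lTrans x u - algebraMap ℝ C(G, ℝ) (lTrans x u 1)) +
        (lTrans x u 1) • (1 : C(G, ℝ)) := by
      rw [Algebra.algebraMap_eq_smul_one]; abel
    have hmemW : lTrans x u - algebraMap ℝ C(G, ℝ) (lTrans x u 1) ∈ W := by
      refine Submodule.mem_sup_left ⟨F.sub_mem hv ?_, sub_const_mem_augIdeal hvR⟩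
      rw [Algebra.algebraMap_eq_smul_one]
      exact F.smul_mem _ h1F
    rw [hsplit, map_add, hδ'.2 _ hmemW, map_smul, hδ'.1.apply_one, smul_zero, add_zero]
  -- the generated closed connected normal subgroup is `⊥` or `⊤`
  haveI := normal_flowSubgroup hfam hR
  rcases hN (flowSubgroup (annihilator W)) inferInstance (isClosed_flowSubgroup _)
    (isPreconnected_flowSubgroup hfam hR) with hbot | htop
  · exact hδu₀ (apply_eq_zero_of_flowSubgroup_eq_bot hfam hbot hδmem hu₀)
  · have haF : a ∈ F := Submodule.mem_sup_left (self_mem_biSpan a)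
    have hfix : ∀ g : G, rTrans g a = a := fun g =>
      rTrans_eq_self_of_mem_flowSubgroup hfam haR (fun δ' hδ' => hkill δ' hδ' a haF)
        (by rw [htop]; exact Subgroup.mem_top g)
    apply ha0
    ext g
    have := congrArg (fun v : C(G, ℝ) => v 1) (hfix g)
    simp only [rTrans_apply, one_mul] at this
    rw [this, ContinuousMap.zero_apply, apply_one_of_mem_augIdeal ha]

/-- **The cotangent space is finitely generated**: under the same hypotheses there is a
finite-dimensional conjugation-invariant `F' ≤ K` with `F' + K² = K`. [folklore] -/
theorem exists_finiteDimensional_sup_augIdealSq_eq [T2Space G]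
    (hN : ∀ N : Subgroup G, N.Normal → IsClosed (N : Set G) → IsPreconnected (N : Set G) → N = ⊥ ∨ N = ⊤)
    (hR : (translationFinite G).SeparatesPoints) :
    ∃ F' : Submodule ℝ C(G, ℝ), FiniteDimensional ℝ F' ∧ F' ≤ augIdeal G ∧ IsConjInvariant F' ∧
      F' ⊔ augIdealSq G = augIdeal G := by
  by_cases hK : augIdeal G = ⊥
  · refine ⟨⊥, inferInstance, bot_le, fun g v hv => ?_, ?_⟩
    · rw [Submodule.mem_bot] at hv; rw [hv, map_zero]; exact Submodule.zero_mem _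
    · rw [bot_sup_eq]; exact le_antisymm augIdealSq_le (by rw [hK]; exact bot_le)
  · obtain ⟨a, ha, ha0⟩ := (Submodule.ne_bot_iff _).mp hK
    haveI : FiniteDimensional ℝ (biSpan a) := IsTranslationFinite.finiteDimensional ha.1
    refine ⟨(biSpan a ⊔ Submodule.span ℝ {(1 : C(G, ℝ))}) ⊓ augIdeal G,
      Submodule.finiteDimensional_inf_left _ _, inf_le_right,
      (isConjInvariant_biSpan_sup_one a).inf isConjInvariant_augIdeal,
      sup_augIdealSq_eq_augIdeal hN hR ha ha0⟩

end Structure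

end Literature.RepresentationTheory.CompactGroups
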